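import Literature.AlgebraicGeometry.ShimuraVarieties.UnitaryAuxiliaryReflexConormTransport   -- ★ `finiteIdeleRelNorm_finiteIdeleConorm_of_hasSmallReflex` (`N(con s) = s`)
import Literature.AlgebraicGeometry.ShimuraVarieties.UnitaryAuxiliaryReflexBookkeeping        -- ★ `exists_ringHom_reflexField`, `hasSmallReflex_of_isGalois`
import Literature.AlgebraicGeometry.ShimuraVarieties.UnitaryAuxiliaryTorusReflexNorm           -- ★ `traceField_le_reflexField`
import Literature.NumberTheory.ComplexMultiplication.IdeleReflexNormIdeals                      -- ★ `toFractionalIdeal_reflexNormFiniteIdele` (`il(g_f x) = g(il x)`)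
import Literature.NumberTheory.ComplexMultiplication.ReflexTypeNormIdealGroups                  -- ★ (19.7a) `fracIdealReflexTypeNorm_eq_fracIdealReflexTypeNorm_fracIdealRelNorm`
import HarnessLib

/-!
# The IDEAL of the reflex norm of a CONORM: `il(g_{Φ,E♯}(con_{E♯/F} s)) = g_F(il(s))` for `F ∕ ℚ` Galois, the reflex type norm read on `F` itself
# ([Shimura 1998] §13.1 (1), (7); §18.5; §19.7 (19.7a); [Milne CM] Ch. I Rem. 1.25, Prop. 1.26)

Topic `AlgebraicGeometry/ShimuraVarieties`; namespace `Literature.AlgebraicGeometry.ShimuraVarieties.UnitaryCanonicalModel.Aux`.  THEOREMS ONLY (no definition,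
no named fact, no instance, no notation, no `sorry`; net debt 0).  Cell `hodgecm-mathlib`, FLOOR 0, P6 «MOD programme» (crux hLiu418 = stmt-HodgeConjecture-24832,
`--supports`), X-LEAF sheet line, (S8) closer `stub_ESHEET`, organ (S6)⊕(S7) `stub_TWIST` («L4» DEAL #30, LA4-p05 (g4)) — the ONE IDEAL BRIDGE shared by both
junction legs (census (B1)∕(S7)-pin): the junction `IsSheetTwistOf` asks for the IDEAL `[t(sE)]` of the reflex norm `t = g_{Φ′,E♯}` of an `E♯`-idèle `sE`,
and both legs produce `sE` as a conorm `con_{E♯/F} s` of an `F`-idèle with KNOWN ideal (`(ϖ_w⁻¹)_w`, resp. a split prime `𝔮`).  Since `E♯ = ι₁(F)` for `F ∕ ℚ`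
Galois (★ `hasSmallReflex_of_isGalois`), the big Galois field `L` of ★ `toFractionalIdeal_reflexNormFiniteIdele` may be taken to be `F` itself (`ι := ι₁`,
`j := id_F`, `σL : E♯ → F` the inverse of `ι₁`, ★ `exists_ringHom_reflexField`), the transitivity (19.7a) ★
`fracIdealReflexTypeNorm_eq_fracIdealReflexTypeNorm_fracIdealRelNorm` descends `g_{E♯}` to `g_F ∘ N_{E♯/F}` along the degree-one tower `F → E♯`
(`σL ∘ (F → E♯) = id_F`), and `N_{E♯/F}(con s) = s` (★ `finiteIdeleRelNorm_finiteIdeleConorm_of_hasSmallReflex`):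

  **`toFractionalIdeal_reflexNormFiniteIdele_finiteIdeleConorm_of_isGalois`**:
  `il(g_{Φ,E♯}(con_{E♯/F} s)) = fracIdealReflexTypeNorm (valuedIn ι₁ Φ) id_F id_F (il s)` — the reflex type norm of the ideal of `s`, read ON `F`
  (type `valuedIn ι₁ Φ = {φ : F → F | ι₁ ∘ φ ∈ Φ}`, reflex embeddings `F → F`), so that for an integral `𝔞` it is ★ `idealReflexTypeNorm (valuedIn ι₁ Φ) id id 𝔞`
  (`fracIdealReflexTypeNorm_coeIdeal`) — LA4-p04՚s ★ p849648 currency at `𝔭_w`, ★ `F0P6aTwistData` currency at a split prime.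

## References
* [Shimura1998] G. Shimura, *Abelian Varieties with Complex Multiplication and Modular Functions* (1998), §13.1 (1), (7) pp. 97–99; §18.5 pp. 123–124; §19.7 (19.7a).
* [MilneCM2006] J. S. Milne, *Complex Multiplication* (2006), Ch. I §1 Prop. 1.23 (7), Rem. 1.25, Prop. 1.26.
* [CasselsFrohlichANT1967] J. W. S. Cassels, A. Fröhlich (eds.), *Algebraic Number Theory* (1967), Ch. II §19 (19.11).
HC_CM is proved only modulo the printed citations (2 remaining named inputs hLiu418 24832, h413 24833) until rung 0 closes — count-neutral.
-/

set_option autoImplicit false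

noncomputable section

open Function NumberField Field IsDedekindDomain
open scoped nonZeroDivisors Pointwise
open Literature.AlgebraicGeometry.Motives
open Literature.NumberTheory.ComplexMultiplication
open Literature.NumberTheory.Automorphic.FiniteAdeleRing (toFractionalIdeal)

namespace Literature.AlgebraicGeometry.ShimuraVarieties

namespace UnitaryCanonicalModel

namespace Aux

open Literature.NumberTheory.AdelicBaseChange (finiteIdeleRelNorm finiteIdeleConorm toFractionalIdeal_finiteIdeleRelNorm)

/-- **THE IDEAL OF THE REFLEX NORM OF A CONORM, READ ON `F`** (`F ∕ ℚ` Galois, so `E♯ = ι₁(F)`): for every finite idèle `s` of `F`,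
`il(g_{Φ,E♯}(con_{E♯/F} s)) = g_F(il(s))` with `g_F = fracIdealReflexTypeNorm (valuedIn ι₁ Φ) id_F id_F` the reflex type norm of FRACTIONAL ideals of `F` for the
reflex type of `Φ` read through `ι₁` — ★ `toFractionalIdeal_reflexNormFiniteIdele` at `L := F`, `σL := ι₁⁻¹|_{E♯}`, then (19.7a) down `F → E♯` (degree one:
`σL ∘ (F → E♯) = id_F`, so the Galois condition is vacuous) and `N_{E♯/F}(con s) = s`.
[cite: Shimura1998, §13.1 (1), (7) pp. 97–99; §18.5 pp. 123–124; §19.7 (19.7a)] [cite: MilneCM2006, Ch. I §1 Rem. 1.25, Prop. 1.26] -/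
theorem toFractionalIdeal_reflexNormFiniteIdele_finiteIdeleConorm_of_isGalois
    (F : Type) [Field F] [NumberField F] [IsCMField F] [IsGalois ℚ F] (Φ : CMType F) (ι₁ : F →+* ℂ) :
    (haveI : NumberField ↥(Aux.reflexField F Φ ι₁) := Aux.numberField_reflexField F Φ ι₁
     letI : Algebra F ↥(Aux.reflexField F Φ ι₁) := (Aux.toReflexField F Φ ι₁).toAlgebra
     ∀ s : (FiniteAdeleRing (𝓞 F) F)ˣ,
       toFractionalIdeal (𝓞 F) F (reflexNormFiniteIdele F Φ (Aux.reflexField F Φ ι₁) (finiteIdeleConorm F ↥(Aux.reflexField F Φ ι₁) s)) =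
         fracIdealReflexTypeNorm (valuedIn ι₁ Φ.1) (RingHom.id F) (RingHom.id F) (toFractionalIdeal (𝓞 F) F s)) := by
  intro s
  haveI : NumberField ↥(reflexField F Φ ι₁) := numberField_reflexField F Φ ι₁
  letI : Algebra F ↥(reflexField F Φ ι₁) := (toReflexField F Φ ι₁).toAlgebra
  -- `σL : E♯ → F`, the inverse of `ι₁` on `E♯ = ι₁(F)`
  have hsm : HasSmallReflex F Φ ι₁ := hasSmallReflex_of_isGalois F Φ ι₁
  have hΦ : ((traceField Φ : IntermediateField ℚ ℂ) : Set ℂ) ⊆ Set.range ι₁ := by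
    intro x hx
    obtain ⟨y, hy⟩ := AlgHom.mem_fieldRange.1 (hsm hx)
    exact ⟨y, hy⟩
  obtain ⟨σL, hσL⟩ := exists_ringHom_reflexField Φ ι₁ ι₁ subset_rfl hΦ
  have hσ : ι₁.comp σL = algebraMap ↥(reflexField F Φ ι₁) ℂ := RingHom.ext fun x => hσL x
  have hcomp : σL.comp (algebraMap F ↥(reflexField F Φ ι₁)) = RingHom.id F := by
    refine RingHom.ext fun x => ι₁.injective ?_
    rw [RingHom.comp_apply, hσL, RingHom.id_apply]
    exact coe_toReflexField_apply F Φ ι₁ x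
  -- the Galois condition of (19.7a) is vacuous down a degree-one tower
  have hk' : ∀ h : F ≃+* F, h • σL.comp (algebraMap F ↥(reflexField F Φ ι₁)) = σL.comp (algebraMap F ↥(reflexField F Φ ι₁)) →
      h • valuedIn ι₁ Φ.1 = valuedIn ι₁ Φ.1 := by
    intro h hh
    rw [hcomp] at hh
    have h1 : h = 1 := by
      apply RingEquiv.ext
      intro x
      have hx := RingHom.congr_fun hh x
      rwa [ringEquiv_smul_apply, RingHom.id_apply] at hx
    rw [h1, one_smul]
  rw [toFractionalIdeal_reflexNormFiniteIdele F Φ (reflexField F Φ ι₁) (traceField_le_reflexField F Φ ι₁) ι₁ (RingHom.id F) σL hσ,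
    fracIdealReflexTypeNorm_eq_fracIdealReflexTypeNorm_fracIdealRelNorm (valuedIn ι₁ Φ.1) (RingHom.id F) σL hk', hcomp,
    ← toFractionalIdeal_finiteIdeleRelNorm, finiteIdeleRelNorm_finiteIdeleConorm_of_hasSmallReflex F Φ ι₁ hsm s]

/-- The same for an `F`-idèle whose ideal is INTEGRAL, in the `idealReflexTypeNorm` spelling of ★ `F0P6aCanonicalTwistIdealAsReflexTypeNorm` ∕ ★ `F0P6aTwistData`:
`il(s) = 𝔞` ⇒ `il(g_{Φ,E♯}(con s)) = idealReflexTypeNorm (valuedIn ι₁ Φ) id id 𝔞`. [cite: Shimura1998, §13.1 (1), (7) pp. 97–99] [cite: MilneCM2006, Ch. I §1 Prop. 1.26] -/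
theorem toFractionalIdeal_reflexNormFiniteIdele_finiteIdeleConorm_of_eq_coeIdeal
    (F : Type) [Field F] [NumberField F] [IsCMField F] [IsGalois ℚ F] (Φ : CMType F) (ι₁ : F →+* ℂ) :
    (haveI : NumberField ↥(Aux.reflexField F Φ ι₁) := Aux.numberField_reflexField F Φ ι₁
     letI : Algebra F ↥(Aux.reflexField F Φ ι₁) := (Aux.toReflexField F Φ ι₁).toAlgebra
     ∀ (s : (FiniteAdeleRing (𝓞 F) F)ˣ) (𝔞 : Ideal (𝓞 F)), 𝔞 ≠ ⊥ →
       toFractionalIdeal (𝓞 F) F s = ((𝔞 : Ideal (𝓞 F)) : FractionalIdeal (𝓞 F)⁰ F) →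
       toFractionalIdeal (𝓞 F) F (reflexNormFiniteIdele F Φ (Aux.reflexField F Φ ι₁) (finiteIdeleConorm F ↥(Aux.reflexField F Φ ι₁) s)) =
         ((idealReflexTypeNorm (valuedIn ι₁ Φ.1) (RingHom.id F) (RingHom.id F) 𝔞 : Ideal (𝓞 F)) : FractionalIdeal (𝓞 F)⁰ F)) := by
  intro s 𝔞 h𝔞 hs
  rw [toFractionalIdeal_reflexNormFiniteIdele_finiteIdeleConorm_of_isGalois F Φ ι₁ s, hs,
    fracIdealReflexTypeNorm_coeIdeal (valuedIn ι₁ Φ.1) (RingHom.id F) (RingHom.id F) h𝔞]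

/-- The same for an `F`-idèle whose ideal is the INVERSE of an integral ideal (the Frobenius leg: `il((ϖ_w⁻¹)_w) = 𝔭_w⁻¹`):
`il(s) = 𝔞⁻¹` ⇒ `il(g_{Φ,E♯}(con s)) = (idealReflexTypeNorm (valuedIn ι₁ Φ) id id 𝔞)⁻¹`. [cite: Shimura1998, §13.1 (1), (7) pp. 97–99; §18.6 proof pp. 127–129] -/
theorem toFractionalIdeal_reflexNormFiniteIdele_finiteIdeleConorm_of_eq_coeIdeal_inv
    (F : Type) [Field F] [NumberField F] [IsCMField F] [IsGalois ℚ F] (Φ : CMType F) (ι₁ : F →+* ℂ) :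
    (haveI : NumberField ↥(Aux.reflexField F Φ ι₁) := Aux.numberField_reflexField F Φ ι₁
     letI : Algebra F ↥(Aux.reflexField F Φ ι₁) := (Aux.toReflexField F Φ ι₁).toAlgebra
     ∀ (s : (FiniteAdeleRing (𝓞 F) F)ˣ) (𝔞 : Ideal (𝓞 F)), 𝔞 ≠ ⊥ →
       toFractionalIdeal (𝓞 F) F s = ((𝔞 : Ideal (𝓞 F)) : FractionalIdeal (𝓞 F)⁰ F)⁻¹ →
       toFractionalIdeal (𝓞 F) F (reflexNormFiniteIdele F Φ (Aux.reflexField F Φ ι₁) (finiteIdeleConorm F ↥(Aux.reflexField F Φ ι₁) s)) =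
         (((idealReflexTypeNorm (valuedIn ι₁ Φ.1) (RingHom.id F) (RingHom.id F) 𝔞 : Ideal (𝓞 F)) : FractionalIdeal (𝓞 F)⁰ F))⁻¹) := by
  intro s 𝔞 h𝔞 hs
  rw [toFractionalIdeal_reflexNormFiniteIdele_finiteIdeleConorm_of_isGalois F Φ ι₁ s, hs, map_inv₀,
    fracIdealReflexTypeNorm_coeIdeal (valuedIn ι₁ Φ.1) (RingHom.id F) (RingHom.id F) h𝔞]

end Aux

end UnitaryCanonicalModel

end Literature.AlgebraicGeometry.ShimuraVarieties

end
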